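/-
b2b-lace packet, LEAN TYPING SEAT 2 gen 16 (unit `b2b-lace-lean2-g16`).  (S2b)-IMPR, the ASSEMBLY node (HOME/LEMMAS CLAIM TABLE "ASM", owner
lean2; REFEREE v72 ORDERS (5)): the x-space weighted diagram `ℋ^{n,l}_p(x)` bounded by the cell bound `F3Bounds.boundHD75 τ n l x r` FROM the five
per-piece integral bounds of [NoBLE17] §3.3.5 Steps 1–5 — kernel assembly of L0 (`nobleH_eq_integral`), L1/L2 (`tauWHat_eq_sum_H`), the landed leaf
L6 (`NobleH4StepD75`, consumed BY NAME) and DISPLAYED leaf hypotheses for Steps 1, 2, 3, 5 typed LITERALLY as the conclusions of `NobleH2Step` (L4,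
landed p192377), `NobleH35Step` (L5+L7, staged) and the Step-1 node (L3, open, DIVERGENCE D80).  d-generic; no numeral, no dimension, no named fact;
NEW module, nothing existing is touched.
-/
import Literature.Probability.FitznerVanDerHofstad2017.NobleH4StepD75
import HarnessLib

/-!
# Literature.Probability.FitznerVanDerHofstad2017.NobleWeightedDiagramAssembly — `|ℋ^{n,l}_p(x)| ≤ Σ_i (bound on piece i)` ([NoBLE17] §3.3.5 (3.58)–(3.59))

[NoBLE17] = R. Fitzner, R. van der Hofstad, *Generalized approach to the non-backtracking lace expansion*, Probab. Theory Related Fields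
169 (2017) 1041–1119.  [FvdH17] = —, *Mean-field behavior for nearest-neighbor percolation in `d > 10`*, Electron. J. Probab. 22 (2017) no. 43.

§3.3.5 of [NoBLE17] bounds the weighted diagram `ℋ^{n,l}_z(x) = Σ_y ‖y‖₂² G_z(y) (D^{*l} * G_z^{*n})(x − y)` ((3.9)–(3.10)) by writing its Fourier
representation, splitting `−ΔĜ_z = Σ_{i=1}^5 Ĥ_i` ((3.52)–(3.57), App. C), and bounding the five pieces

> (3.58) `ℋ^{n,l}_{i,z}(x) = ∫_{[−π,π]^d} Ĥ_i(k) D̂(k)^l Ĝ_z(k)ⁿ D̂^{(x)}(k) dk/(2π)^d`,  (3.59) `ℋ^{n,l}_z(x) = Σ_{i=1}^5 ℋ^{n,l}_{i,z}(x)`,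

one per Step ((3.61), (3.72)–(3.74), (3.75)–(3.77), (3.78), (3.79)–(3.86)); the cell bound is the sum (3.87).  THIS MODULE IS (3.59) AND THE
TRIANGLE INEQUALITY, KERNEL-ASSEMBLED for percolation (`G_z = τ_p`, `p < p_c`): from

* L0 — the Fourier representation `ℋ^{n,l}_p(x) = ∫ D̂^{(x)} · tauWHat · τ̂_pⁿ · D̂^l dk/(2π)^d` (`nobleH_eq_integral`, module
  `NobleWeightedDiagramFourier`);
* L1/L2 — the split `tauWHat d p k = Σ_i Ĥ_i(k)` and `τ̂_p(k) = Ĝ(k)` on the atoms `lapAtomsAt d c_Φ α_Φ c_F α_F R_Φ R_F k` of a simplified-form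
  witness, at every `k` where `1 − F̂(k) ≠ 0 ≠ 1 − F̂(0) + α_F[1 − D̂(k)]` (`tauWHat_eq_sum_H`, module `NobleLaplacianSplit`) — which the key-quantity
  bounds `KeyBounds r` (`NobleLaplacianBounds`; delivered below `p_c` under `f₂ ≤ Γ₂` by `keyBounds_and_split`) give at every `k` of the cube with
  `D̂(k) < 1`, i.e. almost everywhere (`ae_mem_cube_and_Dhat_lt_one`);
* the five per-piece bounds `|∫ Ĥ_i Ĝⁿ D̂^l D̂^{(x)} dk/(2π)^d| ≤ (summand i of the cell bound)`: Step 4 is DISCHARGED here by the landed leaf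
  `abs_integral_H4_diagram_le_boundH4D75_lapAtomsAt` (`NobleH4StepD75`, App.-C-consistent form, DIVERGENCE D75); Steps 1, 2, 3, 5 enter as the
  DISPLAYED hypotheses `hH1`, `hH2`, `hH3`, `hH5`, typed LITERALLY as the conclusions of the leaf theorems that discharge them —
  `NobleH2Step.abs_integral_H2_diagram_le_boundH2_lapAtomsAt` (landed, p192377; its own hypotheses are the two DISPLAYED inequalities of DIVERGENCE D79,
  (H-Γ) `Γ₂′ⁿ β_{R,Φ} ≤ β_{ΔR,Φ}` and (H-T) `TS_{m,l}(x) ≤ τ.T m l x`, which therefore surface BY NAME exactly where this module's `hH2` is instantiated —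
  REFEREE v72 ORDERS (5)), `NobleH35Step.abs_integral_H3_diagram_le_boundH3_lapAtomsAt` / `…H5…` (staged re-file of p192022), and the Step-1 node
  (L3; [NoBLE17] (3.61)–(3.62), whose displayed form is under DIVERGENCE D80 — whatever Step-1 bound lands is consumed through `hH1` against the table
  entry `F3Bounds.boundH1`);
* integrability of the five signed pieces (`hI1`–`hI5`, DISPLAYED: the leaves bound `|∫ piece_i|` by monotonicity against an integrable majorant and
  do not need it, but (3.59) — linearity of the integral — does; they follow from the measurability of the atoms of `lapAtomsAt` (continuity of
  `cosFT`/`sinFT` of summable families) and the same majorants, node ASM-a of HOME/LEMMAS, owed),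

it proves `|ℋ^{n,l}_p(x)| ≤ F3Bounds.boundHD75 τ n l x r` (`= boundH1 + boundH2 + boundH3 + boundH4D75 + boundH5`, module `F3BoundsD75`) for every
table `τ` whose `K`-entries are the SRW integrals `srwK` — the per-`x` form of the improvement-step bound that Cert rev 8 / rev 9's cells `D11.bo8` /
`D11.bo9` majorise numerically (the sup over the cell `S_k` and the table instantiation are node L8b, owner num3).  No analytic fact is asserted here:
the theorem is bookkeeping over named inputs, each of which is either a tree theorem or a displayed binder.
[cite: FitznerVanDerHofstad2016NoBLE, §3.3.5 (3.58)–(3.59) p. 1074 and (3.87) p. 1079; §3.3.4 (3.52)–(3.57) pp. 1073–1074; §3.3.1 (3.9)–(3.10) p. 1067]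
-/

noncomputable section

open MeasureTheory Real
open Literature.Barriers.CriticalPhenomena
open Literature.Barriers.CriticalPhenomena.Slade2006Prop53 (P)
open Literature.Probability.LatticeModels
open Literature.Probability.Percolation
open Literature.Probability.RandomPlanarGeometry.SAW.Zd (normSq)

namespace Literature.Probability.FitznerVanDerHofstad2017

variable {d : ℕ}

/-- **(3.59) a.e.: the integrand of `ℋ^{n,l}_p(x)` is the sum of the five piece integrands.**  Below `p_c`, for a simplified-form witness
`(c_Φ, α_Φ, c_F, α_F, R_Φ, R_F)` of `τ̂_p` with summable remainders of finite absolute second moment whose atoms obey `KeyBounds r` on the cube off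
`{D̂ = 1}`: for a.e. `k`, `D̂^{(x)} · tauWHat · τ̂_pⁿ · D̂^l = Σ_{i=1}^5 Ĥ_i Ĝⁿ D̂^l D̂^{(x)}`.
[cite: FitznerVanDerHofstad2016NoBLE, §3.3.4 (3.57) and §3.3.5 (3.58)–(3.59), PTRF p. 1074] -/
theorem ae_nobleH_integrand_eq_sum_pieces (hd : 2 ≤ d) {p : unitInterval}
    (hp : (p : ℝ) < criticalProb (zdGraph d) (0 : Site d)) {cΦ αΦ cF αF : ℝ} {RΦ RF : Site d → ℝ}
    (hRΦ : Summable RΦ) (hRF : Summable RF) (hRΦ2 : Summable fun x => normSq x * |RΦ x|)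
    (hRF2 : Summable fun x => normSq x * |RF x|)
    (hform : ∀ k ∈ cube d,
      tauHat d p k * (1 - (cF + αF * Dhat d k + cosFT RF k)) = cΦ + αΦ * Dhat d k + cosFT RΦ k)
    {r : F3Bounds.Args} (hKB : ∀ k ∈ cube d, Dhat d k < 1 → (lapAtomsAt d cΦ αΦ cF αF RΦ RF k).KeyBounds r)
    (n l : ℕ) (x : Site d) :
    ∀ᵐ k ∂P d, DhatSym d x k * (tauWHat d p k * (tauHat d p k ^ n * Dhat d k ^ l)) =
      (lapAtomsAt d cΦ αΦ cF αF RΦ RF k).H1 * (lapAtomsAt d cΦ αΦ cF αF RΦ RF k).G ^ n * Dhat d k ^ l * DhatSym d x k +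
      (lapAtomsAt d cΦ αΦ cF αF RΦ RF k).H2 * (lapAtomsAt d cΦ αΦ cF αF RΦ RF k).G ^ n * Dhat d k ^ l * DhatSym d x k +
      (lapAtomsAt d cΦ αΦ cF αF RΦ RF k).H3 * (lapAtomsAt d cΦ αΦ cF αF RΦ RF k).G ^ n * Dhat d k ^ l * DhatSym d x k +
      (lapAtomsAt d cΦ αΦ cF αF RΦ RF k).H4 * (lapAtomsAt d cΦ αΦ cF αF RΦ RF k).G ^ n * Dhat d k ^ l * DhatSym d x k +
      (lapAtomsAt d cΦ αΦ cF αF RΦ RF k).H5 * (lapAtomsAt d cΦ αΦ cF αF RΦ RF k).G ^ n * Dhat d k ^ l * DhatSym d x k := by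
  filter_upwards [ae_mem_cube_and_Dhat_lt_one (d := d) (by omega)] with k hk
  have hkb := hKB k hk.1 hk.2
  obtain ⟨hG, hW⟩ := tauWHat_eq_sum_H hd p hp hRΦ hRF hRΦ2 hRF2 hform k hkb.Q_pos.ne' hkb.Cden_pos.ne'
  rw [hW, hG]
  ring

/-- **[NoBLE17] (3.59) with the triangle inequality, kernel-assembled: `|ℋ^{n,l}_p(x)| ≤ boundH1 + boundH2 + boundH3 + boundH4D75 + boundH5
= F3Bounds.boundHD75 τ n l x r`.**  Hypotheses: `d ≥ 2n + 5`; `p < p_c`; a simplified-form witness with summable remainders of finite absolute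
second moment (`hform`, as recorded by `NobleSimplifiedFormF3At`); the key-quantity bounds `KeyBounds r` of its atoms on the cube off `{D̂ = 1}`
(`keyBounds_and_split`); a table `τ` with `K`-entries `= srwK` ((3.36)); integrability of the five signed piece integrands (`hI1`–`hI5`, node ASM-a);
and the per-piece bounds of Steps 1, 2, 3, 5 as DISPLAYED hypotheses `hH1`, `hH2`, `hH3`, `hH5` — typed literally as the conclusions of the Step-1
node (L3), `abs_integral_H2_diagram_le_boundH2_lapAtomsAt` (`NobleH2Step`; under (H-Γ), (H-T) of DIVERGENCE D79), and
`abs_integral_H3_diagram_le_boundH3_lapAtomsAt` / `abs_integral_H5_diagram_le_boundH5_lapAtomsAt` (`NobleH35Step`).  Step 4 is discharged inside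
by `abs_integral_H4_diagram_le_boundH4D75_lapAtomsAt` (App.-C-consistent form, DIVERGENCE D75).
[cite: FitznerVanDerHofstad2016NoBLE, §3.3.5 (3.58)–(3.59) p. 1074, Steps 1–5 (3.61)–(3.86) pp. 1075–1079, (3.87) p. 1079] -/
theorem abs_nobleH_le_boundHD75_of_pieces {n : ℕ} (hd : 2 * (n + 2) + 1 ≤ d) {p : unitInterval}
    (hp : (p : ℝ) < criticalProb (zdGraph d) (0 : Site d)) {cΦ αΦ cF αF : ℝ} {RΦ RF : Site d → ℝ}
    (hRΦ : Summable RΦ) (hRF : Summable RF) (hRΦ2 : Summable fun x => normSq x * |RΦ x|)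
    (hRF2 : Summable fun x => normSq x * |RF x|)
    (hform : ∀ k ∈ cube d,
      tauHat d p k * (1 - (cF + αF * Dhat d k + cosFT RF k)) = cΦ + αΦ * Dhat d k + cosFT RΦ k)
    {r : F3Bounds.Args} (hKB : ∀ k ∈ cube d, Dhat d k < 1 → (lapAtomsAt d cΦ αΦ cF αF RΦ RF k).KeyBounds r)
    (τ : F3Bounds.Tables (Fin d → ℤ)) (hK : ∀ m l x, τ.K m l x = srwK d m l x) (l : ℕ) (x : Site d)
    (hI1 : Integrable (fun k => (lapAtomsAt d cΦ αΦ cF αF RΦ RF k).H1 * (lapAtomsAt d cΦ αΦ cF αF RΦ RF k).G ^ n *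
      Dhat d k ^ l * DhatSym d x k) (P d))
    (hI2 : Integrable (fun k => (lapAtomsAt d cΦ αΦ cF αF RΦ RF k).H2 * (lapAtomsAt d cΦ αΦ cF αF RΦ RF k).G ^ n *
      Dhat d k ^ l * DhatSym d x k) (P d))
    (hI3 : Integrable (fun k => (lapAtomsAt d cΦ αΦ cF αF RΦ RF k).H3 * (lapAtomsAt d cΦ αΦ cF αF RΦ RF k).G ^ n *
      Dhat d k ^ l * DhatSym d x k) (P d))
    (hI4 : Integrable (fun k => (lapAtomsAt d cΦ αΦ cF αF RΦ RF k).H4 * (lapAtomsAt d cΦ αΦ cF αF RΦ RF k).G ^ n *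
      Dhat d k ^ l * DhatSym d x k) (P d))
    (hI5 : Integrable (fun k => (lapAtomsAt d cΦ αΦ cF αF RΦ RF k).H5 * (lapAtomsAt d cΦ αΦ cF αF RΦ RF k).G ^ n *
      Dhat d k ^ l * DhatSym d x k) (P d))
    (hH1 : |(∫ k, (lapAtomsAt d cΦ αΦ cF αF RΦ RF k).H1 * (lapAtomsAt d cΦ αΦ cF αF RΦ RF k).G ^ n *
        Dhat d k ^ l * DhatSym d x k ∂P d) / (2 * π) ^ d| ≤ F3Bounds.boundH1 τ n l x r)
    (hH2 : |(∫ k, (lapAtomsAt d cΦ αΦ cF αF RΦ RF k).H2 * (lapAtomsAt d cΦ αΦ cF αF RΦ RF k).G ^ n *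
        Dhat d k ^ l * DhatSym d x k ∂P d) / (2 * π) ^ d| ≤ F3Bounds.boundH2 τ n l x r)
    (hH3 : |(∫ k, (lapAtomsAt d cΦ αΦ cF αF RΦ RF k).H3 * (lapAtomsAt d cΦ αΦ cF αF RΦ RF k).G ^ n *
        Dhat d k ^ l * DhatSym d x k ∂P d) / (2 * π) ^ d| ≤ F3Bounds.boundH3 τ n l x r)
    (hH5 : |(∫ k, (lapAtomsAt d cΦ αΦ cF αF RΦ RF k).H5 * (lapAtomsAt d cΦ αΦ cF αF RΦ RF k).G ^ n *
        Dhat d k ^ l * DhatSym d x k ∂P d) / (2 * π) ^ d| ≤ F3Bounds.boundH5 τ n l x r) :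
    |nobleH d n l p x| ≤ F3Bounds.boundHD75 τ n l x r := by
  have hd2 : 2 ≤ d := by omega
  have hH4 := abs_integral_H4_diagram_le_boundH4D75_lapAtomsAt hd hKB τ hK l x
  have hae := ae_nobleH_integrand_eq_sum_pieces hd2 hp hRΦ hRF hRΦ2 hRF2 hform hKB n l x
  have hI12 : Integrable (fun k =>
      (lapAtomsAt d cΦ αΦ cF αF RΦ RF k).H1 * (lapAtomsAt d cΦ αΦ cF αF RΦ RF k).G ^ n * Dhat d k ^ l * DhatSym d x k +
      (lapAtomsAt d cΦ αΦ cF αF RΦ RF k).H2 * (lapAtomsAt d cΦ αΦ cF αF RΦ RF k).G ^ n * Dhat d k ^ l * DhatSym d x k) (P d) :=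
    hI1.add hI2
  have hI123 : Integrable (fun k =>
      (lapAtomsAt d cΦ αΦ cF αF RΦ RF k).H1 * (lapAtomsAt d cΦ αΦ cF αF RΦ RF k).G ^ n * Dhat d k ^ l * DhatSym d x k +
      (lapAtomsAt d cΦ αΦ cF αF RΦ RF k).H2 * (lapAtomsAt d cΦ αΦ cF αF RΦ RF k).G ^ n * Dhat d k ^ l * DhatSym d x k +
      (lapAtomsAt d cΦ αΦ cF αF RΦ RF k).H3 * (lapAtomsAt d cΦ αΦ cF αF RΦ RF k).G ^ n * Dhat d k ^ l * DhatSym d x k) (P d) :=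
    hI12.add hI3
  have hI1234 : Integrable (fun k =>
      (lapAtomsAt d cΦ αΦ cF αF RΦ RF k).H1 * (lapAtomsAt d cΦ αΦ cF αF RΦ RF k).G ^ n * Dhat d k ^ l * DhatSym d x k +
      (lapAtomsAt d cΦ αΦ cF αF RΦ RF k).H2 * (lapAtomsAt d cΦ αΦ cF αF RΦ RF k).G ^ n * Dhat d k ^ l * DhatSym d x k +
      (lapAtomsAt d cΦ αΦ cF αF RΦ RF k).H3 * (lapAtomsAt d cΦ αΦ cF αF RΦ RF k).G ^ n * Dhat d k ^ l * DhatSym d x k +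
      (lapAtomsAt d cΦ αΦ cF αF RΦ RF k).H4 * (lapAtomsAt d cΦ αΦ cF αF RΦ RF k).G ^ n * Dhat d k ^ l * DhatSym d x k) (P d) :=
    hI123.add hI4
  rw [nobleH_eq_integral hd2 n l p hp x, integral_congr_ae hae, integral_add hI1234 hI5, integral_add hI123 hI4,
    integral_add hI12 hI3, integral_add hI1 hI2]
  simp only [add_div]
  unfold F3Bounds.boundHD75
  refine le_trans (abs_add_le _ _) ?_
  refine le_trans (add_le_add (abs_add_le _ _) le_rfl) ?_
  refine le_trans (add_le_add (add_le_add (abs_add_le _ _) le_rfl) le_rfl) ?_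
  refine le_trans (add_le_add (add_le_add (add_le_add (abs_add_le _ _) le_rfl) le_rfl) le_rfl) ?_
  exact add_le_add (add_le_add (add_le_add (add_le_add hH1 hH2) hH3) hH4) hH5

end Literature.Probability.FitznerVanDerHofstad2017

end
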